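import Mathlib
import Literature.Analysis.Convexity.OpenHPolytope
import Literature.Analysis.Convexity.AnisotropicPerimeterPolytopePrism
import Literature.MeasureTheory.Integral.HPolytopeGaussGreenOpen
import HarnessLib

/-!
# Open `H`-polytopes of `ℝ³`: unit normal form, sign-symmetric facet frames, separation, contact planes

Topic `Literature/Analysis/Convexity`; namespace `Literature.Analysis.Convexity`.  Plumbing for the
facet formula of a finite disjoint UNION of open polytopes (internal facets cancel):
* the UNIT NORMAL FORM of an `H`-representation (`‖p.1‖⁻¹ • p.1`, zero normals dropped): same open
  polytope when nonempty (`openHPolytope_normalForm_eq`), unit normals, pairwise non-proportional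
  constraints (`not_proportional_of_mem_normalForm`);
* `exists_symmetric_frames` — facet frames `U, V ⊥ a` chosen as a function of the unoriented plane
  (`U(-a) = U(a)`), so the charts of `(a, b)` and `(-a, -b)` coincide;
* `exists_unit_separator` — Hahn–Banach for two disjoint open convex sets with a unit normal;
* `volume_chartPreimage_contact_eq_zero_of_same_side` — two disjoint open convex sets on the SAME side
  of a plane touch it (jointly) only in a null set of the chart;
* `exists_mem_or_neg_mem_of_volume_contact_ne_zero` — a plane carrying a non-null part of
  `closure A ∩ closure B` (`A` an open polytope, `B` disjoint from `A`) is a facet plane of `A`.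
[cite: Rockafellar1970, §6 Thm 6.3 and §11 Thm 11.3; EvansGariepy2015, Thm 5.16 (Gauss–Green), polyhedral case — plumbing]
-/

noncomputable section

namespace Literature.Analysis.Convexity

open _root_.MeasureTheory Set
open scoped RealInnerProductSpace Topology
open Literature.MeasureTheory.Integral

/-! ### The unit normal form of an `H`-representation -/

/-- Every constraint of the unit normal form has a unit normal.
[cite: Rockafellar1970, §6 Thm 6.3 — plumbing] -/
theorem norm_eq_one_of_mem_normalForm (H : Finset (EuclideanSpace ℝ (Fin 3) × ℝ))
    {c : EuclideanSpace ℝ (Fin 3) × ℝ}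
    (hc : c ∈ (H.filter (fun p => p.1 ≠ 0)).image (fun p => (‖p.1‖⁻¹ • p.1, ‖p.1‖⁻¹ * p.2))) :
    ‖c.1‖ = 1 := by
  obtain ⟨p, hp, rfl⟩ := Finset.mem_image.1 hc
  have hp0 : p.1 ≠ 0 := (Finset.mem_filter.1 hp).2
  simp only [norm_smul, norm_inv, norm_norm]
  exact inv_mul_cancel₀ (norm_ne_zero_iff.2 hp0)

/-- The open polytope of `H` lies in the open polytope of its unit normal form.
[cite: Rockafellar1970, §6 Thm 6.3 — plumbing] -/
theorem openHPolytope_subset_normalForm (H : Finset (EuclideanSpace ℝ (Fin 3) × ℝ)) :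
    (⋂ p ∈ H, {x : EuclideanSpace ℝ (Fin 3) | ⟪p.1, x⟫ < p.2}) ⊆
      ⋂ c ∈ (H.filter (fun p => p.1 ≠ 0)).image (fun p => (‖p.1‖⁻¹ • p.1, ‖p.1‖⁻¹ * p.2)),
        {x : EuclideanSpace ℝ (Fin 3) | ⟪c.1, x⟫ < c.2} := by
  intro x hx
  simp only [mem_iInter, mem_setOf_eq] at hx ⊢
  intro c hc
  obtain ⟨p, hp, rfl⟩ := Finset.mem_image.1 hc
  have hpH : p ∈ H := (Finset.mem_filter.1 hp).1
  have hp0 : 0 < ‖p.1‖⁻¹ := inv_pos.2 (norm_pos_iff.2 (Finset.mem_filter.1 hp).2)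
  simp only [inner_smul_left, RCLike.conj_to_real]
  exact mul_lt_mul_of_pos_left (hx p hpH) hp0

/-- For a NONEMPTY open polytope, the unit normal form describes the same set.
[cite: Rockafellar1970, §6 Thm 6.3 — plumbing] -/
theorem openHPolytope_normalForm_eq (H : Finset (EuclideanSpace ℝ (Fin 3) × ℝ))
    (hne : (⋂ p ∈ H, {x : EuclideanSpace ℝ (Fin 3) | ⟪p.1, x⟫ < p.2}).Nonempty) :
    (⋂ c ∈ (H.filter (fun p => p.1 ≠ 0)).image (fun p => (‖p.1‖⁻¹ • p.1, ‖p.1‖⁻¹ * p.2)),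
        {x : EuclideanSpace ℝ (Fin 3) | ⟪c.1, x⟫ < c.2}) =
      ⋂ p ∈ H, {x : EuclideanSpace ℝ (Fin 3) | ⟪p.1, x⟫ < p.2} := by
  refine Subset.antisymm ?_ (openHPolytope_subset_normalForm H)
  obtain ⟨x₀, hx₀⟩ := hne
  intro x hx
  simp only [mem_iInter, mem_setOf_eq] at hx hx₀ ⊢
  intro p hp
  by_cases hp0 : p.1 = 0
  · have := hx₀ p hp
    rw [hp0, inner_zero_left] at this ⊢
    exact this
  · have hmem : (‖p.1‖⁻¹ • p.1, ‖p.1‖⁻¹ * p.2) ∈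
        (H.filter (fun p => p.1 ≠ 0)).image (fun p => (‖p.1‖⁻¹ • p.1, ‖p.1‖⁻¹ * p.2)) :=
      Finset.mem_image.2 ⟨p, Finset.mem_filter.2 ⟨hp, hp0⟩, rfl⟩
    have h := hx _ hmem
    simp only [inner_smul_left, RCLike.conj_to_real] at h
    have hpos : 0 < ‖p.1‖ := norm_pos_iff.2 hp0
    have := mul_lt_mul_of_pos_left h hpos
    rwa [← mul_assoc, ← mul_assoc, mul_inv_cancel₀ hpos.ne', one_mul, one_mul] at this

/-- For a NONEMPTY open polytope, distinct constraints of the unit normal form are not proportional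
(`(a, b)` and `(-a, -b)` cannot both occur: the polytope would be empty).
[cite: Rockafellar1970, §6 Thm 6.3 — plumbing] -/
theorem not_proportional_of_mem_normalForm (H : Finset (EuclideanSpace ℝ (Fin 3) × ℝ))
    (hne : (⋂ p ∈ H, {x : EuclideanSpace ℝ (Fin 3) | ⟪p.1, x⟫ < p.2}).Nonempty)
    {c c' : EuclideanSpace ℝ (Fin 3) × ℝ}
    (hc : c ∈ (H.filter (fun p => p.1 ≠ 0)).image (fun p => (‖p.1‖⁻¹ • p.1, ‖p.1‖⁻¹ * p.2)))
    (hc' : c' ∈ (H.filter (fun p => p.1 ≠ 0)).image (fun p => (‖p.1‖⁻¹ • p.1, ‖p.1‖⁻¹ * p.2)))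
    (hcc' : c ≠ c') : ¬ ∃ μ : ℝ, c'.1 = μ • c.1 ∧ c'.2 = μ * c.2 := by
  rintro ⟨μ, hμ1, hμ2⟩
  have h1 := norm_eq_one_of_mem_normalForm H hc
  have h1' := norm_eq_one_of_mem_normalForm H hc'
  have hμ : |μ| = 1 := by
    have := congrArg norm hμ1
    rw [norm_smul, h1, h1', Real.norm_eq_abs, mul_one] at this
    exact this.symm
  rcases abs_eq (zero_le_one) |>.1 hμ with h | h
  · subst h
    rw [one_smul] at hμ1
    rw [one_mul] at hμ2
    exact hcc' (Prod.ext hμ1.symm hμ2.symm)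
  · subst h
    obtain ⟨x₀, hx₀⟩ := hne
    have hx₀' := openHPolytope_subset_normalForm H hx₀
    simp only [mem_iInter, mem_setOf_eq] at hx₀'
    have a1 := hx₀' c hc
    have a2 := hx₀' c' hc'
    rw [hμ1, hμ2, neg_one_smul, inner_neg_left] at a2
    linarith

/-! ### Sign-symmetric facet frames -/

/-- **Facet frames chosen as a function of the unoriented plane.**  There are `U, V : ℝ³ → ℝ³`
assigning to every unit vector `a` an orthonormal pair `⊥ a`, with `U (-a) = U a`, `V (-a) = V a`
(so the charts `c.2 • c.1 + y₁ U(c.1) + y₂ V(c.1)` of `(a, b)` and `(-a, -b)` coincide).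
[cite: EvansGariepy2015, Thm 5.16 (Gauss–Green) — plumbing] -/
theorem exists_symmetric_frames :
    ∃ U V : EuclideanSpace ℝ (Fin 3) → EuclideanSpace ℝ (Fin 3),
      (∀ a, ‖a‖ = 1 → ‖U a‖ = 1 ∧ ‖V a‖ = 1 ∧ ⟪U a, V a⟫ = 0 ∧ ⟪a, U a⟫ = 0 ∧ ⟪a, V a⟫ = 0) ∧
      (∀ a, U (-a) = U a ∧ V (-a) = V a) := by
  classical
  letI : LinearOrder (EuclideanSpace ℝ (Fin 3)) := WellOrderingRel.isWellOrder.linearOrder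
  have hex := fun a : EuclideanSpace ℝ (Fin 3) => exists_orthonormal_pair_perp a
  choose U₀ V₀ hU₀ hV₀ hUV₀ haU₀ haV₀ using hex
  refine ⟨fun a => U₀ (min a (-a)), fun a => V₀ (min a (-a)), fun a ha => ?_, fun a => ?_⟩
  · have key : ∀ r, (r = a ∨ r = -a) →
        ‖U₀ r‖ = 1 ∧ ‖V₀ r‖ = 1 ∧ ⟪U₀ r, V₀ r⟫ = 0 ∧ ⟪a, U₀ r⟫ = 0 ∧ ⟪a, V₀ r⟫ = 0 := by
      rintro r (rfl | rfl)
      · exact ⟨hU₀ _, hV₀ _, hUV₀ _, haU₀ _, haV₀ _⟩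
      · refine ⟨hU₀ _, hV₀ _, hUV₀ _, ?_, ?_⟩
        · have := haU₀ (-a); rwa [inner_neg_left, neg_eq_zero] at this
        · have := haV₀ (-a); rwa [inner_neg_left, neg_eq_zero] at this
    exact key _ (min_choice a (-a))
  · show U₀ (min (-a) (- -a)) = U₀ (min a (-a)) ∧ V₀ (min (-a) (- -a)) = V₀ (min a (-a))
    rw [neg_neg, min_comm]
    exact ⟨rfl, rfl⟩

/-! ### Separation of two disjoint open convex sets by a unit normal -/

/-- **Hahn–Banach with a unit normal.**  Two disjoint nonempty open convex sets of `ℝ³` are separated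
by a plane `⟪ν, x⟫ = u` with `‖ν‖ = 1`: `A ⊆ {⟪ν, ·⟫ < u}`, `B ⊆ {⟪-ν, ·⟫ < -u}`.
[cite: Rockafellar1970, §11 Thm 11.3 — plumbing] -/
theorem exists_unit_separator {A B : Set (EuclideanSpace ℝ (Fin 3))} (hAc : Convex ℝ A)
    (hAo : IsOpen A) (hBc : Convex ℝ B) (hBo : IsOpen B) (hAB : Disjoint A B) (hA : A.Nonempty)
    (hB : B.Nonempty) :
    ∃ d : EuclideanSpace ℝ (Fin 3) × ℝ, ‖d.1‖ = 1 ∧ A ⊆ {x | ⟪d.1, x⟫ < d.2} ∧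
      B ⊆ {x | ⟪-d.1, x⟫ < -d.2} := by
  obtain ⟨f, u, hfA, hfB⟩ := geometric_hahn_banach_open_open hAc hAo hBc hBo hAB
  set w : EuclideanSpace ℝ (Fin 3) := (InnerProductSpace.toDual ℝ (EuclideanSpace ℝ (Fin 3))).symm f
    with hw
  have hfw : ∀ x, f x = ⟪w, x⟫ := fun x => by
    rw [hw, InnerProductSpace.toDual_symm_apply]
  have hw0 : w ≠ 0 := by
    intro h0
    obtain ⟨a, ha⟩ := hA
    obtain ⟨b, hb⟩ := hB
    have h1 := hfA a ha
    have h2 := hfB b hb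
    rw [hfw, h0, inner_zero_left] at h1 h2
    linarith
  have hwpos : 0 < ‖w‖ := norm_pos_iff.2 hw0
  refine ⟨(‖w‖⁻¹ • w, ‖w‖⁻¹ * u), ?_, fun x hx => ?_, fun x hx => ?_⟩
  · simp [norm_smul, inv_mul_cancel₀ hwpos.ne']
  · show ⟪‖w‖⁻¹ • w, x⟫ < ‖w‖⁻¹ * u
    rw [inner_smul_left, RCLike.conj_to_real, ← hfw]
    exact mul_lt_mul_of_pos_left (hfA x hx) (inv_pos.2 hwpos)
  · show ⟪-(‖w‖⁻¹ • w), x⟫ < -(‖w‖⁻¹ * u)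
    rw [inner_neg_left, inner_smul_left, RCLike.conj_to_real, ← hfw, neg_lt_neg_iff]
    exact mul_lt_mul_of_pos_left (hfB x hx) (inv_pos.2 hwpos)

/-! ### Contact sets of two disjoint open polytopes -/

/-- **Same-side contact is null.**  If two disjoint nonempty open convex sets both lie in the open
half-space `{⟪c.1, ·⟫ < c.2}` (`‖c.1‖ = 1`), the chart of the plane `⟪c.1, ·⟫ = c.2` meets
`closure A ∩ closure B` in a null set. [cite: EvansGariepy2015, Thm 5.16 (Gauss–Green) — plumbing] -/
theorem volume_chartPreimage_contact_eq_zero_of_same_side {A B : Set (EuclideanSpace ℝ (Fin 3))}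
    (hAc : Convex ℝ A) (hAo : IsOpen A) (hBc : Convex ℝ B) (hBo : IsOpen B) (hAB : Disjoint A B)
    (hA : A.Nonempty) (hB : B.Nonempty) (c : EuclideanSpace ℝ (Fin 3) × ℝ) (h1 : ‖c.1‖ = 1)
    (U V : EuclideanSpace ℝ (Fin 3)) (hU1 : ‖U‖ = 1) (hV1 : ‖V‖ = 1) (hUV : ⟪U, V⟫ = 0)
    (haU : ⟪c.1, U⟫ = 0) (haV : ⟪c.1, V⟫ = 0)
    (hAside : A ⊆ {x | ⟪c.1, x⟫ < c.2}) (hBside : B ⊆ {x | ⟪c.1, x⟫ < c.2}) :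
    volume ((fun y : ℝ × ℝ => c.2 • c.1 + y.1 • U + y.2 • V) ⁻¹' (closure A ∩ closure B)) = 0 := by
  obtain ⟨d, hd1, hAd, hBd⟩ := exists_unit_separator hAc hAo hBc hBo hAB hA hB
  -- `closure A ∩ closure B` lies in the plane of `d`
  have hcont : closure A ∩ closure B ⊆ {x : EuclideanSpace ℝ (Fin 3) | ⟪d.1, x⟫ = d.2} := by
    have hcA : closure A ⊆ {x : EuclideanSpace ℝ (Fin 3) | ⟪d.1, x⟫ ≤ d.2} :=
      closure_minimal (fun x hx => show ⟪d.1, x⟫ ≤ d.2 from le_of_lt (hAd hx))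
        (isClosed_le (continuous_const.inner continuous_id) continuous_const)
    have hcB : closure B ⊆ {x : EuclideanSpace ℝ (Fin 3) | ⟪-d.1, x⟫ ≤ -d.2} :=
      closure_minimal (fun x hx => show ⟪-d.1, x⟫ ≤ -d.2 from le_of_lt (hBd hx))
        (isClosed_le (continuous_const.inner continuous_id) continuous_const)
    intro x hx
    have h1x : ⟪d.1, x⟫ ≤ d.2 := hcA hx.1
    have h2x : ⟪-d.1, x⟫ ≤ -d.2 := hcB hx.2
    rw [inner_neg_left] at h2x
    exact le_antisymm h1x (by linarith)
  by_cases hprop : ∃ μ : ℝ, d.1 = μ • c.1 ∧ d.2 = μ * c.2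
  · -- `d = ± c`: one of the two sets would be empty
    exfalso
    obtain ⟨μ, hμ1, hμ2⟩ := hprop
    have hμ : |μ| = 1 := by
      have := congrArg norm hμ1
      rw [norm_smul, h1, hd1, Real.norm_eq_abs, mul_one] at this
      exact this.symm
    rcases abs_eq (zero_le_one) |>.1 hμ with h | h
    · subst h
      rw [one_smul] at hμ1
      rw [one_mul] at hμ2
      obtain ⟨b, hb⟩ := hB
      have e1 : ⟪c.1, b⟫ < c.2 := hBside hb
      have e2 : ⟪-d.1, b⟫ < -d.2 := hBd hb
      rw [hμ1, hμ2, inner_neg_left] at e2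
      linarith
    · subst h
      obtain ⟨a, ha⟩ := hA
      have e1 : ⟪c.1, a⟫ < c.2 := hAside ha
      have e2 : ⟪d.1, a⟫ < d.2 := hAd ha
      rw [hμ1, hμ2, neg_one_smul, inner_neg_left] at e2
      linarith
  · exact measure_mono_null (preimage_mono hcont)
      (volume_chartPreimage_plane_eq_zero c d U V h1 hU1 hV1 hUV haU haV hprop)

/-- **A positive-area contact plane is a facet plane.**  Let `A = ⋂_{c ∈ J} {⟪c.1, ·⟫ < c.2}` be a
nonempty open polytope with unit normals and `B` a set disjoint from `A`.  If the chart of the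
plane of a unit constraint `d` meets `closure A ∩ closure B` in a non-null set, then `d` or
`(-d.1, -d.2)` is one of the constraints of `J`. [cite: EvansGariepy2015, Thm 5.16 (Gauss–Green) — plumbing] -/
theorem exists_mem_or_neg_mem_of_volume_contact_ne_zero (J : Finset (EuclideanSpace ℝ (Fin 3) × ℝ))
    (h1 : ∀ c ∈ J, ‖c.1‖ = 1)
    (hne : (⋂ c ∈ J, {x : EuclideanSpace ℝ (Fin 3) | ⟪c.1, x⟫ < c.2}).Nonempty)
    {B : Set (EuclideanSpace ℝ (Fin 3))}
    (hAB : Disjoint (⋂ c ∈ J, {x : EuclideanSpace ℝ (Fin 3) | ⟪c.1, x⟫ < c.2}) B)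
    (d : EuclideanSpace ℝ (Fin 3) × ℝ) (hd1 : ‖d.1‖ = 1) (U V : EuclideanSpace ℝ (Fin 3))
    (hU1 : ‖U‖ = 1) (hV1 : ‖V‖ = 1) (hUV : ⟪U, V⟫ = 0) (haU : ⟪d.1, U⟫ = 0) (haV : ⟪d.1, V⟫ = 0)
    (hvol : volume ((fun y : ℝ × ℝ => d.2 • d.1 + y.1 • U + y.2 • V) ⁻¹'
      (closure (⋂ c ∈ J, {x : EuclideanSpace ℝ (Fin 3) | ⟪c.1, x⟫ < c.2}) ∩ closure B)) ≠ 0) :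
    d ∈ J ∨ (-d.1, -d.2) ∈ J := by
  by_contra hcon
  push Not at hcon
  apply hvol
  rw [closure_openHPolytope_eq J hne]
  -- every contact point has an active constraint, whose plane is non-proportional to `d`
  have hcover : (fun y : ℝ × ℝ => d.2 • d.1 + y.1 • U + y.2 • V) ⁻¹'
        ((⋂ c ∈ J, {x : EuclideanSpace ℝ (Fin 3) | ⟪c.1, x⟫ ≤ c.2}) ∩ closure B) ⊆
      ⋃ c ∈ J, (fun y : ℝ × ℝ => d.2 • d.1 + y.1 • U + y.2 • V) ⁻¹'
        {x : EuclideanSpace ℝ (Fin 3) | ⟪c.1, x⟫ = c.2} := by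
    intro y hy
    obtain ⟨hyP, hyB⟩ := hy
    by_contra hnot
    simp only [mem_iUnion, mem_preimage, mem_setOf_eq, not_exists] at hnot
    have hyQ : d.2 • d.1 + y.1 • U + y.2 • V ∈ ⋂ c ∈ J, {x : EuclideanSpace ℝ (Fin 3) | ⟪c.1, x⟫ < c.2} := by
      simp only [mem_iInter, mem_setOf_eq] at hyP ⊢
      exact fun c hc => lt_of_le_of_ne (hyP c hc) (hnot c hc)
    have hdis : Disjoint (⋂ c ∈ J, {x : EuclideanSpace ℝ (Fin 3) | ⟪c.1, x⟫ < c.2}) (closure B) :=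
      hAB.closure_right (isOpen_openHPolytope J)
    exact Set.disjoint_left.1 hdis hyQ hyB
  refine measure_mono_null hcover ((measure_biUnion_null_iff J.countable_toSet).2 fun c hc => ?_)
  refine volume_chartPreimage_plane_eq_zero d c U V hd1 hU1 hV1 hUV haU haV ?_
  rintro ⟨μ, hμ1, hμ2⟩
  have hμ : |μ| = 1 := by
    have := congrArg norm hμ1
    rw [norm_smul, hd1, h1 c hc, Real.norm_eq_abs, mul_one] at this
    exact this.symm
  rcases abs_eq (zero_le_one) |>.1 hμ with h | h
  · subst h
    rw [one_smul] at hμ1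
    rw [one_mul] at hμ2
    exact hcon.1 (by rwa [show d = c from Prod.ext hμ1.symm hμ2.symm])
  · subst h
    rw [neg_one_smul] at hμ1
    rw [neg_one_mul] at hμ2
    have hdc : ((-d.1, -d.2) : EuclideanSpace ℝ (Fin 3) × ℝ) = c := Prod.ext hμ1.symm hμ2.symm
    exact hcon.2 (by rwa [hdc])



end Literature.Analysis.Convexity

end
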